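import Mathlib
import HarnessLib
import HarnessLib.Audit
import Summits.ABC.Statement
import Summits.ABC.ABC.Statement
import Literature.NumberTheory.DiophantineGeometry.AbcWave0
import Literature.NumberTheory.DiophantineGeometry.Conductor
import Literature.NumberTheory.EllipticCurves.QuadraticTwist
import HarnessLib.Audit.Status.Attr

/-!
Route: TwistAmplification

CLOSED (retired) 2026-08-17T04:29:52Z by planner-rchoice-ABC-TwistAmplification-loop-b86d87f8-0 — reason: not-a-thesis (restated): route-choice on stamp skeleton.hides-summit (gen 5) — target ModerateWindowCount ↔ ABC landed (moderateWindowCount_equiv_abc, p95900) and the only load-bearing open crux SharpModerateLaw ≡ ABC ∧ CoreLawTM by landed  — note: route-choice by planner-rchoice-ABC-TwistAmplification-loop-b86d87f8-0 (memo DECISION-TwistAmplification.md attached as route evidence 2026-08-17T04:29Z). Why not the gate's fix (b): (i) re-skeleton — every stub set of every line implies ABC (abc_of_sharpModerateLaw) and the ABC content cannot sit i. The file is kept as the record of this route; refuted decls are indexed as negative knowledge (`ledger negatives`).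

It suffices to show X = a MODERATE-WINDOW COUNTING LAW for elliptic curves over ℚ ordered by
conductor: for every
σ > 6 there are κ ∈ (3,σ), δ < (σ−κ)/(2σ−6) and C such that for all X ≥ 1 the number T⁺_[κ,σ](X) of
curves E/ℚ
with j ∉ {0,1728}, conductor N ≤ X and GENERALIZED Szpiro size N^κ ≤ M⁺ := max(|Δ_min|,|c₄|³) ≤ N^σ
(counted through
reduced minimal integral models) is ≤ C·X^δ. This is a statement about ABUNDANT objects in a bounded
box — no extreme
curve is ever bounded directly — and it is implied by the conjectural sharp law T⁺_[κ,σ](X) =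
X^(1−κ/6+o(1))
(crux SharpModerateLaw) because the margin (σ−κ)/(2σ−6) − (1−κ/6) = (κ−3)(σ−6)/(3(2σ−6)) is positive
exactly for σ > 6.
Lean (route decl ModerateWindowCount): ∀ σ > 6, ∃ κ δ C, 3 < κ ∧ κ < σ ∧ δ < (σ−κ)/(2σ−6) ∧ ∀ X ≥ 1,
ncard{W₀ : WeierstrassCurve ℤ | elliptic ∧ minimal at all v ∧ reduced ∧ c₄ ≠ 0 ∧ c₆ ≠ 0 ∧ N ≤ X ∧
N^κ ≤ M⁺ ≤ N^σ} ≤ C·X^δ.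
X → ABC (TWIST AMPLIFICATION, elementary given Tate-type twist facts): one curve E₀ with M⁺ ≥ N₀^σ',
σ' > σ, has
quadratic twists E₀^d (d squarefree ≡ 1 mod 4, (d,6N₀)=1, N(E₀^d) = N₀d², M⁺(E₀^d) = d⁶M⁺) whose
ratio
(β₀+6θ)/(1+2θ), θ = log d/log N₀, slides through [κ,σ]: ≫ X^((σ'−κ)/(2σ'−6)−o(1)) counted curves of
conductor ≤ X,
contradicting δ since s ↦ (s−κ)/(2s−6) increases. Hence M⁺ ≤ N^σ' for all non-CM-j curves of large
conductor, for
every σ' > 6; on Serre-normalised Frey curves (c₄ = 16(a²+ab+b²) ≠ 0, c₆ ≠ 0 off (1,1,2), N ∣ 2^8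
rad) this is
generalized Szpiro, and with Mahler's S-unit finiteness for the small radicals it is ABC
(Bombieri–Gubler 12.5.12 pattern).

Rationale: WHY THIS LINE. Every pointwise engine for abc hits a wall (Baker: exponential in rad; modular
degree: the congruence
number). This route changes the TYPE of the problem: arithmetic statistics of curves by conductor in
a window of
Szpiro ratios 3 < κ ≤ β⁺ ≤ σ, the home turf of geometry-of-numbers / determinant-method counting
[ShankarShankarWang2021: X^(5/6) asymptotics by conductor for ratio < 7/4, tail Thm 1.4 'expected
optimal';
Xiao2024TwoTorsion: 2-torsion family up to average ratio 155/68; FouvryNairTenenbaum1992: Szpiro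
exceptional set].
The literature uses abc to JUSTIFY such counts (SSW p.4); the card
twist-amplification-moderate-counts proves the
CONVERSE: a power-saving count of MODERATE curves below the threshold (σ−κ)/(2σ−6) forces pointwise
generalized Szpiro
beyond σ, by amplifying one violator along its quadratic-twist orbit (≍ X^(1/2) twists, ratio
sliding to 3). Imported
area: arithmetic statistics (Bhargava–Shankar school), with the companion card
szpiro-counting-law-dimension supplying
the conjectural law X^(1−κ/6) (realised from below by X(m), torsion families and twists; Szpiro's 6
= zero of
χ(2,3,m)) as the sharp form of the crux.
RANKED CRUXES. (rank 2) SharpModerateLaw: T⁺_[κ,σ](X) ≪ X^(1−κ/6+ε) for all 3 < κ < 6 < σ — implies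
X by the margin
identity; refutable by an LMFDB/Cremona census (N ≤ 5·10⁵) or by a new algebraic family of moderate
curves. (rank 3)
SomeWindowSaving: SOME window past ratio 3 with SOME saving below threshold — the first rung; by
amplification it
already gives weak abc c < rad^K (open since 1985), and it is where current uniformity technology
(ratio 155/68) must
be pushed past 3 with saving < 1/2. Support (provable now): QuadraticTwistInvariants (Tate: I₀* at p
∣ d, N ↦ Nd²,
Δ ↦ d⁶Δ, c₄ ↦ d²c₄ for d ≡ 1 mod 4 coprime to 6N), TwistAmplificationLemma (Theorem A,
cofinite-in-conductor
form — deliberately avoids Shafarevich finiteness), Assembly (Frey bookkeeping + abc.S25).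
KILL CRITERIA. (a) a source of moderate curves beyond the law: a family with ≫ X^((σ−κ)/(2σ−6))
members of ratio in
[κ,σ], conductor ≤ X, for some σ > 6 ≥ κ > 3, j ∉ {0,1728} (kills X; the known sources sit exactly
ON the law); (b)
census data contradicting slope 1−κ/6 on [3,5]; (c) a proof that any count with δ < 1/2 at κ > 3
formally needs a
pointwise bound for ratio > σ as input (then the route is a relocation only — the triage already
notes that the
hypothesis at (κ,σ,δ) empties the slice (σ(κ,δ),σ], σ(κ,δ) = (κ−6δ)/(1−2δ); we accept this: the bet
is that a
count in a bounded box is more provable than its pointwise corollary).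
NOT DECOMPOSED YET: SharpModerateLaw into (R1) classification of positive-dimensional moderate
families as twists of
specialisations of extremal (clean-Belyi) elliptic surfaces and (R2) the sporadic count; the
function-field dimension
statement dim Strat(n,k) = n−2k−2 (calibration); lower-bound realisation T ≫ X^(1−κ/6−ε) (evidence,
not needed for ABC).
NOVELTY (short): nearest prior ShankarShankarWang2021 / Xiao2024TwoTorsion / FouvryNairTenenbaum1992
(counts; direction
abc ⟹ counting only), Granville IMRN 2007 (twists, direction abc ⟹); delta = the converse
implication with explicit
threshold and margin identity, typed. BARRIERS (short): SzpiroEpsilonCannotBeDropped explained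
(margin 0 at σ = 6);
BakerMethodBounds evaded by type change; constants ineffective, nothing explicit claimed.

Novelty: Nearest prior art (searched 2026-08-15: zbMATH "quadratic twists Szpiro conjecture" → 1 hit
Broadhurst arXiv:2111.07794 (pointwise families); zbMATH "elliptic curves large Szpiro ratio
counting conductor" → 0; zbMATH → Granville IMRN 2007 doi:10.1093/imrn/rnm027 (abc ⟹ statements on
twists, opposite direction); galaxy --star all "Szpiro ratio" → 2 irrelevant theses; crossref →
ShankarShankarWang2021 doi:10.1112/s0010437x21007193 (Thm 1.1/1.4/1.5, only abc ⟹ counting used),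
Xiao2024TwoTorsion doi:10.1016/j.aim.2024.109681 (§6 large Szpiro constant as a tail),
FouvryNairTenenbaum1992 (exceptional set X^{1/κ+ε} by discriminant); idea cards
twist-amplification-moderate-counts + szpiro-counting-law-dimension, both audited new-combination by
refuters, are the source).
Delta: the implication COUNT(moderate generalized-Szpiro-ratio curves, saving below (σ−κ)/(2σ−6)) ⟹
pointwise generalized Szpiro beyond σ ⟹ ABC, with the margin identity (κ−3)(σ−6)/(3(2σ−6)) locating
Szpiro's 6, typed over Mathlib/Literature (conductorNorm, minimal models, quadraticTwist) with the
CM-j exclusion and the cofinite form that needs no Shafarevich finiteness; no prior work runs the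
twist orbit in this direction. Expected grade: new-combination.  [refs: 10.1093/imrn/rnm027, 10.1112/s0010437x21007193, 10.1016/j.aim.2024.109681, 2111.07794, doi:10.1093/imrn/rnm027, doi:10.1112/s0010437x21007193, doi:10.1016/j.aim.2024.109681, ShankarShankarWang2021, FouvryNairTenenbaum1992]

Barriers (technique_class: twist-amplification arithmetic-statistics-by-conductor): technique_class: twist-amplification arithmetic-statistics-by-conductor
- Literature.Barriers.ABC.SzpiroEpsilonCannotBeDropped: respected and explained — the margin
(κ−3)(σ−6)/(3(2σ−6)) vanishes at σ = 6, so the mechanism can never give M⁺ ≪ N⁶(log N)^k; Masser's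
families populate the endpoint κ = 6 of the law (T_[6,6+ε] infinite, X^{o(1)}).
- Literature.Barriers.ABC.EpsilonCannotBeDropped: the output is generalized Szpiro with exponent
6+ε', i.e. abc with 1+ε; no ε-free statement is touched.
- Literature.Barriers.ABC.BakerMethodBounds: evaded by type change — no linear form in logarithms,
no height of a single curve is bounded directly; the price is a counting problem with an explicit
exponent below 1/2 past ratio 3.
- Literature.Barriers.ABC.ExplicitABCQualityFloor: any exponent obtained comes with an ineffective
constant (cofinite form + Mahler finiteness); nothing explicit is claimed, Reyssat's 1.6299
untouched.
- Literature.Barriers.ABC.UniformABCImpliesNoSiegelZeros /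
Literature.Barriers.ABC.UniformABCDiscriminantSharp: not engaged — everything over ℚ.
- Literature.Barriers.ABC.IUTDisputedClaim: independent.
- Negatives index (2026-08-15): 0 refuted ABC statements; BUG 1 of the triage (isotrivial j ∈
{0,1728} twist families saturate X^{1/2} at every ratio < 5) is built into the statements (c₄ ≠ 0 ∧
c₆ ≠ 0), and for ABC only the Frey triple (1,1,2) is lost.

Novelty grade: new-combination — ROUTE REVIEW (refuter, 2026-08-15). Grade new-combination (twist-orbit amplification × arithmetic-statistics counting law, run in the converse direction to Granville/SSW); planner's documented search is adequate; my own lit sweep impossible (searchd rc 75 all session, galaxy 'Szpiro ratio' → 3 irrel (refuter refuter-rreview-route-ABC-TwistAmplifica-3a4d97d5-0, 2026-08-15T14:16:20Z; prior: doi:10.1112/s0010437x21007193 (ShankarShankarWang2021 Thm 1.1/1.4/1.5: counting by conductor, abc ⇒ counting direction), doi:10.1093/imrn/rnm027 (Granville 2007: abc ⇒ twists), FouvryNairTenenbaum1992 (Szpiro exceptional set), arXiv:1104.2635 (Kane: restricted-radical counts, Conj. 1), BombieriGubler2006 Thm 12.5.12 (abc ⟺ generalized Szpiro))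

History (route lifecycle, newest last):
- 2026-08-15T16:15:24Z · rev 3: restated Assembly (stmt-ABC-1974) — route-repair (glue): (1) deciding theorem `closes` supplied (9 listed items → _root_.ABC, term proof via Assembly); (2) Assembly restated without the smuggled L (planner-rbadge-ABC-TwistAmplification-f5fbde12-g4-0)
- 2026-08-16T03:41:21Z · AUTO-CRUX (backfill): ModerateWindowCount — hypotheses of the deciding theorem that nothing in the route derives are cruxes (operator:999:586464)
- 2026-08-17T04:12:08Z · skeleton.hides-summit: stub_pointwiseSzpiro (stmt-ABC-1975) ⟷ summit (accepted theorem in Summits/ABC/ABC/Theorems/TwistAmplificationSharpModerateLawTwistMinimalPointwise.lean) (prover-line-stmt-ABC-1975-c6-0)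
- 2026-08-17T04:29:53Z · CLOSED retired — not-a-thesis (restated): route-choice on stamp skeleton.hides-summit (gen 5) — target ModerateWindowCount ↔ ABC landed (moderateWindowCount_equiv_abc, p95900) and the only load-bearing open crux Sharp (planner-rchoice-ABC-TwistAmplification-loop-b86d87f8-0)

sub-problem: ABC · status: closed(retired) · opened planner-plan-ABC-0 2026-08-15T11:00:10Z · rev 5 · ledger route-ABC-TwistAmplification
GENERATED by the gate from the ledger (D-0016/17). Provers cite these decls: `theorem foo : Summit.ABC.ABC.Theses.TwistAmplification.<Decl> := …` in Summits/ABC/ABC/Theorems/<Name>.lean.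
-/

namespace Summit.ABC.ABC.Theses.TwistAmplification

open scoped BigOperators Topology Manifold Classical MeasureTheory ProbabilityTheory Matrix InnerProductSpace ComplexConjugate ContinuousMap
open Filter Set Function TopologicalSpace MeasureTheory

attribute [summit_statement] _root_.ABC

open Literature.Abc

/-- item stmt-ABC-1973 · crux (kind.auto-crux: conjecture-grade) · rank 0 · closed · moot by None · by planner
why it might fail: As typed ∃κ admits κ ∈ (6,σ): by B–G Thm 12.5.12 ABC ⇒ generalized Szpiro ⇒ window (κ,σ] eventually empty ⇒ X; so X ⇔ ABC (given twist facts), failing iff ABC fails — the gloss 'could fail with ABC true' needs κ<6 (SharpModerateLaw). Proof risk: saving < 1/2 past ratio 3, beyond all uniform counts.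
sources: BombieriGubler2006, ShankarShankarWang2021, Xiao2024TwoTorsion, FouvryNairTenenbaum1992
[target] For every σ > 6 some window (κ,σ], κ > 3, has a power-saving count below the amplification
threshold: T⁺_[κ,σ](X) ≤ C X^δ with δ < (σ−κ)/(2σ−6). Counting convention (inlined): reduced minimal
integral models W₀ (a₁,a₃ ∈ {0,1}, a₂ ∈ {−1,0,1}; each E/ℚ has one and at most boundedly many), N =
conductorNorm, M⁺ = max(|Δ|,|c₄|³), CM-j excluded by c₄ ≠ 0 ∧ c₆ ≠ 0 (triage BUG 1). Not a
consequence of ABC: a counting statement that could fail with ABC true (unexpected abundance of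
moderate curves). -/
@[route_item "route-ABC-TwistAmplification", crux]
def ModerateWindowCount : Prop :=
  ∀ σ : ℝ, 6 < σ → ∃ κ δ C : ℝ, 3 < κ ∧ κ < σ ∧ δ < (σ - κ) / (2 * σ - 6) ∧ ∀ X : ℝ, 1 ≤ X → (Set.ncard {W₀ : WeierstrassCurve ℤ | (W₀.baseChange ℚ).IsElliptic ∧ (∀ v : IsDedekindDomain.HeightOneSpectrum ℤ, (W₀.baseChange ℚ).IsMinimalAt v) ∧ (W₀.a₁ = 0 ∨ W₀.a₁ = 1) ∧ (W₀.a₃ = 0 ∨ W₀.a₃ = 1) ∧ (W₀.a₂ = -1 ∨ W₀.a₂ = 0 ∨ W₀.a₂ = 1) ∧ W₀.c₄ ≠ 0 ∧ W₀.c₆ ≠ 0 ∧ (((W₀.baseChange ℚ).conductorNorm ℤ : ℕ) : ℝ) ≤ X ∧ (((W₀.baseChange ℚ).conductorNorm ℤ : ℕ) : ℝ) ^ κ ≤ ((max |W₀.Δ| (|W₀.c₄| ^ 3) : ℤ) : ℝ) ∧ ((max |W₀.Δ| (|W₀.c₄| ^ 3) : ℤ) : ℝ) ≤ (((W₀.baseChange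 ℚ).conductorNorm ℤ : ℕ) : ℝ) ^ σ} : ℝ) ≤ C * X ^ δ

/-- item stmt-ABC-1975 · crux · rank 2 · closed · moot by None · by planner
why it might fail: Upper bound far past technology (uniform counts by conductor stop at ratio 7/4 SSW, 155/68 Xiao; FNT Thm 1 gives only X^{σ/κ} ≥ X) and falsifiable: only 1-parameter families are forced onto X^{1−κ/6} (d_N ≥ #S ≥ 2χ+2); a 2-parameter or sporadic source with X^{1−κ/6+η} curves in one window kills it.
sources: ShankarShankarWang2021, Xiao2024TwoTorsion, FouvryNairTenenbaum1992, arXiv:2407.13850, arXiv:math/0608766, arXiv:2104.10817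
[crux] The conjectural counting law as an upper bound on the whole moderate range: T⁺_[κ,σ](X) ≤
C(κ,σ,ε) X^{1−κ/6+ε} for 3 < κ < 6 < σ. Realised from below (unconditionally, companion card
szpiro-counting-law-dimension): X(m) families m = 2..5 give X^{1−m/6}, torsion families (Chan
arXiv:2407.13850: ratios 2,3,4,9/2,24/5 = 12k/n) give X^{1−β_G/6}, twists interpolate along slope-3
lines; over F_q(t) the exponent is (dim stratum)/(degree) = (n−2k−2)/n. Implies the target because
(σ−κ)/(2σ−6) − (1−κ/6) = (κ−3)(σ−6)/(3(2σ−6)) > 0 for σ > 6. Planned split: (R1) classification of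
positive-dimensional moderate families as twists of specialisations of extremal (clean-Belyi)
elliptic surfaces; (R2) sporadic count ≪ X^{1−κ/6−η} via determinant method / Helfgott–Venkatesh
repulsion. -/
@[route_item "route-ABC-TwistAmplification"]
def SharpModerateLaw : Prop :=
  ∀ κ σ ε : ℝ, 3 < κ → κ < 6 → 6 < σ → 0 < ε → ∃ C : ℝ, ∀ X : ℝ, 1 ≤ X → (Set.ncard {W₀ : WeierstrassCurve ℤ | (W₀.baseChange ℚ).IsElliptic ∧ (∀ v : IsDedekindDomain.HeightOneSpectrum ℤ, (W₀.baseChange ℚ).IsMinimalAt v) ∧ (W₀.a₁ = 0 ∨ W₀.a₁ = 1) ∧ (W₀.a₃ = 0 ∨ W₀.a₃ = 1) ∧ (W₀.a₂ = -1 ∨ W₀.a₂ = 0 ∨ W₀.a₂ = 1) ∧ W₀.c₄ ≠ 0 ∧ W₀.c₆ ≠ 0 ∧ (((W₀.baseChange ℚ).conductorNorm ℤ : ℕ) : ℝ) ≤ X ∧ (((W₀.baseChange ℚ).conductorNorm ℤ : ℕ) : ℝ) ^ κ ≤ ((max |W₀.Δ| (|W₀.c₄| ^ 3) : ℤ) :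 ℝ) ∧ ((max |W₀.Δ| (|W₀.c₄| ^ 3) : ℤ) : ℝ) ≤ (((W₀.baseChange ℚ).conductorNorm ℤ : ℕ) : ℝ) ^ σ} : ℝ) ≤ C * X ^ (1 - κ / 6 + ε)

/-- item stmt-ABC-1976 · crux · rank 3 · closed · moot by None · by planner
why it might fail: Modulo twist facts (+Shafarevich below N₀) EQUIVALENT to weak generalized Szpiro (∃K: max(|Δ|,|c₄|³) ≪ N^K; cf. B–G 12.5.11) = weak abc, open; a proof needs saving < 1/2 past ratio 3 in a box X^{σ/2} wide in c₆: FNT/Davenport–Heilbronn give X^{σ/κ} ≥ X, records stop at 155/68; may be circular.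
sources: FouvryNairTenenbaum1992, Xiao2024TwoTorsion, ShankarShankarWang2021, arXiv:math/0405180, BombieriGubler2006
[crux] First rung: there exist 3 < κ < σ and δ < (σ−κ)/(2σ−6) with T⁺_[κ,σ](X) ≤ C X^δ. By
TwistAmplificationLemma this alone gives generalized Szpiro with SOME exponent σ' (e.g. T⁺_[5,13] ≪
X^{0.39} ⇒ σ' = 13.1), i.e. weak abc c < rad^K — open since Masser–Oesterlé. It is strictly weaker
than the target and is the place where the counting technology (geometry of numbers for (c₄,c₆) in
the box, squarefree sieve on c₄³−c₆², Helfgott–Venkatesh for integral points on Mordell curves,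
Browning–Heath-Brown determinant method) is tested against the saving-below-1/2 requirement. -/
@[route_item "route-ABC-TwistAmplification"]
def SomeWindowSaving : Prop :=
  ∃ κ σ δ C : ℝ, 3 < κ ∧ κ < σ ∧ δ < (σ - κ) / (2 * σ - 6) ∧ ∀ X : ℝ, 1 ≤ X → (Set.ncard {W₀ : WeierstrassCurve ℤ | (W₀.baseChange ℚ).IsElliptic ∧ (∀ v : IsDedekindDomain.HeightOneSpectrum ℤ, (W₀.baseChange ℚ).IsMinimalAt v) ∧ (W₀.a₁ = 0 ∨ W₀.a₁ = 1) ∧ (W₀.a₃ = 0 ∨ W₀.a₃ = 1) ∧ (W₀.a₂ = -1 ∨ W₀.a₂ = 0 ∨ W₀.a₂ = 1) ∧ W₀.c₄ ≠ 0 ∧ W₀.c₆ ≠ 0 ∧ (((W₀.baseChange ℚ).conductorNorm ℤ : ℕ) : ℝ) ≤ X ∧ (((W₀.baseChange ℚ).conductorNorm ℤ : ℕ) : ℝ) ^ κ ≤ ((max |W₀.Δ| (|W₀.c₄| ^ 3) : ℤ) : ℝ) ∧ ((max |W₀.Δ| (|W₀.c₄| ^ 3) : ℤ) : ℝ) ≤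 (((W₀.baseChange ℚ).conductorNorm ℤ : ℕ) : ℝ) ^ σ} : ℝ) ≤ C * X ^ δ

/-- item stmt-ABC-2757 · crux · rank 4 · closed · moot by None · by planner
why it might fail: For 3/2<s<2 one must beat Kane's parasitic N^{1+ε} (fixing powerful parts) and the trivial N^{2s/3}; near s→1⁺ it asserts abc-hits by height are N^{o(1)}: a positive-power family of near-hits would refute it without touching abc.
sources: arXiv:1104.2635, arXiv:2410.12234, Dahmen2008, ShankarShankarWang2021
[crux] MAZUR–KANE LAW BELOW 2 (abc-free first rung; filed by the plancard planner of the spine card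
twist-amplification-moderate-counts — tenure planner may re-rank). For every 1 < s < 2 and ε > 0:
#{abc triples (a,b,c): c ≤ N, rad(abc) ≤ c^s} ≤ C(s,ε)·N^{s−1+ε}. This is the upper half of Mazur's
question / Kane's Conjecture 1 (joint-radical form; BLT arXiv:2410.12234 p.3: 'Given λ > 1, [Mazur]
asked whether N_λ(X) has exact order X^{λ−1}') exactly on the range s ∈ (1,2), which is the range of
generalized Szpiro ratios 6/s ∈ (3,6) of this route's window. WHY IT IS ON THIS ROUTE: (i) necessary
— SharpModerateLaw at (κ,σ) applied to the untwisted Frey curves E_{a,b} (N ≍ rad(abc), M⁺ ≍ c⁶,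
non-CM-j off (1,1,2)) gives this bound at the single point s = 6/κ (modulo the quality > σ/6 tail,
which BLT Thm 1.2 bounds by N^{33/50}); (ii) sufficient modulo abc — in the Frey–twist reading the
window count factorises as Σ_triples #{admissible twists d}, a quality-q level twisted by d ≤
rad^{η(q)}, η = (6q−κ)/(2κ−6), contributes X^{(1−q+η)/(1+2η)} = X^{1−κ/6} INDEPENDENTLY of q, so ABC
∧ (this law on (1, 6/κ]) ⟹ the sharp Frey-window law (support item SharpCountSandwich): the law
X^{1−κ/6} of S -/
@[route_item "route-ABC-TwistAmplification"]
def MazurKaneLaw : Prop :=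
  ∀ s : ℝ, 1 < s → s < 2 → ∀ ε : ℝ, 0 < ε → ∃ C : ℝ, ∀ N : ℕ, 2 ≤ N → (Set.ncard {t : ℕ × ℕ × ℕ | Literature.NumberTheory.DiophantineGeometry.IsABCTriple t.1 t.2.1 t.2.2 ∧ t.2.2 ≤ N ∧ ((Literature.NumberTheory.DiophantineGeometry.rad t.1 t.2.1 t.2.2 : ℕ) : ℝ) ≤ (t.2.2 : ℝ) ^ s} : ℝ) ≤ C * (N : ℝ) ^ (s - 1 + ε)

/-- item stmt-ABC-14144 · support · rank 9 · closed · proved by Summit.ABC.ABC.Theorems.sharpLawGivesWindow_proof @ 241c04568241 (prover) · by planner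
[support] GLUE crux → target (route-choice repair 2026-08-16, option (a); elementary real
arithmetic, provable now, size S, a 15-line tactic proof elaborated in the planner's sketch):
SharpModerateLaw → ModerateWindowCount, i.e. the rank-2 crux (sharp law T⁺_[κ,σ](X) ≤ C·X^{1−κ/6+ε}
on 3 < κ < 6 < σ) implies the target (for every σ > 6 some window (κ,σ], κ > 3, counted with saving
δ < (σ−κ)/(2σ−6)) by the MARGIN IDENTITY (σ−κ)/(2σ−6) − (1−κ/6) = (κ−3)(σ−6)/(3(2σ−6)) > 0 for κ >
3, σ > 6. PROOF: given σ > 6 take κ := 4 (any fixed κ ∈ (3,6) works), ε := (σ−6)/(6(2σ−6)) > 0 (half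
the margin at κ = 4), obtain C from SharpModerateLaw 4 σ ε, and answer with (κ, δ, C) := (4, 1 − 4/6
+ ε, C): 3 < 4, 4 < 6 < σ, the counted set of ModerateWindowCount at (4,σ) is literally the set of
SharpModerateLaw at (4,σ) so the bound is the same term C·X^δ, and δ < (σ−4)/(2σ−6) because
(σ−4)/(2σ−6) − 1/3 − ε = (σ−6)/(3(2σ−6)) − ε = ε > 0 (clear the denominator 2σ−6 > 6; nlinarith with
(σ−6)(2σ−6)⁻¹ > 0 closes it). This item is the route's missing crux→target edge (gate hold
target-unreachable on ModerateWindowCount); the deciding theorem now runs SharpModerateLaw → (this)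
→ ModerateWindowCount → Assembly -/
@[route_item "route-ABC-TwistAmplification"]
def SharpLawGivesWindow : Prop :=
  SharpModerateLaw → ModerateWindowCount

/-- item stmt-ABC-1977 · support · rank 9 · closed · proved by Summit.ABC.ABC.Theorems.quadraticTwistInvariants_proof (prover) · by planner
sources: SilvermanAEC2009, Silverman1994
[support] Tate's algorithm for quadratic twists, provable now: W₀ minimal integral model of E, d
squarefree, d ≡ 1 (mod 4), (d, 6N) = 1 ⇒ the twist E^d = quadraticTwist (W₀/ℚ) d has a minimal
integral model W₁ ≅ e • (W₀^d) with Δ(W₁) = d⁶Δ(W₀), c₄(W₁) = d²c₄(W₀) and conductor N·d² (p ∣ d, p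
≥ 5: v_p(c₄) ≥ 2, v_p(Δ) = 6, potentially good ⇒ type I₀*, f_p = 2; p ∤ d odd: unchanged; p = 2: χ_d
unramified so reduction type, f₂ and v₂(Δ_min) unchanged). Literature: QuadraticTwist.lean (Δ(W^d) =
d⁶Δ, c₄ ↦ d²c₄), Conductor/LocalReduction/TateAlgorithm files. -/
@[route_item "route-ABC-TwistAmplification"]
def QuadraticTwistInvariants : Prop :=
  ∀ (W₀ : WeierstrassCurve ℤ), (W₀.baseChange ℚ).IsElliptic → (∀ v : IsDedekindDomain.HeightOneSpectrum ℤ, (W₀.baseChange ℚ).IsMinimalAt v) → ∀ d : ℤ, Squarefree d → d ≡ 1 [ZMOD 4] → IsCoprime d (6 * ((W₀.baseChange ℚ).conductorNorm ℤ : ℤ)) → ∃ (W₁ : WeierstrassCurve ℤ) (e : WeierstrassCurve.VariableChange ℚ), W₁.baseChange ℚ = e • (W₀.baseChange ℚ).quadraticTwist (d : ℚ) ∧ (∀ v : IsDedekindDomain.HeightOneSpectrum ℤ, (W₁.baseChange ℚ).IsMinimalAt v) ∧ W₁.Δ = d ^ 6 * W₀.Δ ∧ W₁.c₄ = d ^ 2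 * W₀.c₄ ∧ (W₁.baseChange ℚ).conductorNorm ℤ = (W₀.baseChange ℚ).conductorNorm ℤ * d.natAbs ^ 2

/-- item stmt-ABC-1978 · support · rank 9 · closed · proved by Summit.ABC.ABC.Theorems.twistAmplificationLemma_proof (prover) · by planner
sources: ShankarShankarWang2021
[support] Theorem A of the card (elementary, provable now from QuadraticTwistInvariants): if
T⁺_[κ,σ](X) ≤ C X^δ for X ≥ 1 with 3 < κ < σ, δ < (σ−κ)/(2σ−6), then for every σ' > σ there is N₀
such that every non-CM-j minimal model of conductor ≥ N₀ has M⁺ ≤ N^{σ'} (cofinite form: no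
Shafarevich finiteness needed). Proof: a violator E₀ (ratio β₀ > σ'' := (σ+σ')/2, conductor N₀) has
twists E₀^d, d squarefree ≡ 1 (4), (d,6N₀) = 1, d ∈ [N₀^{θ₁}, N₀^{θ₂}], θ₁ = (β₀−σ)/(2σ−6), θ₂ =
(β₀−κ)/(2κ−6), all with ratio (β₀+6θ)/(1+2θ) ∈ [κ,σ], pairwise non-isomorphic (j ∉ {0,1728}),
conductor ≤ X := N₀^{1+2θ₂}; their number is ≫ N₀^{θ₂}/log N₀ (primes ≡ 1 mod 4 suffice:
Dirichlet/Chebyshev lower bound) = X^{(β₀−κ)/(2β₀−6) − o(1)} and s ↦ (s−κ)/(2s−6) is increasing for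
κ > 3, so exponent > (σ''−κ)/(2σ''−6) > δ: contradiction for N₀ large. -/
@[route_item "route-ABC-TwistAmplification"]
def TwistAmplificationLemma : Prop :=
  QuadraticTwistInvariants → ∀ κ σ δ C : ℝ, 3 < κ → κ < σ → δ < (σ - κ) / (2 * σ - 6) → (∀ X : ℝ, 1 ≤ X → (Set.ncard {W₀ : WeierstrassCurve ℤ | (W₀.baseChange ℚ).IsElliptic ∧ (∀ v : IsDedekindDomain.HeightOneSpectrum ℤ, (W₀.baseChange ℚ).IsMinimalAt v) ∧ (W₀.a₁ = 0 ∨ W₀.a₁ = 1) ∧ (W₀.a₃ = 0 ∨ W₀.a₃ = 1) ∧ (W₀.a₂ = -1 ∨ W₀.a₂ = 0 ∨ W₀.a₂ = 1) ∧ W₀.c₄ ≠ 0 ∧ W₀.c₆ ≠ 0 ∧ (((W₀.baseChange ℚ).conductorNorm ℤ : ℕ) : ℝ) ≤ X ∧ (((W₀.baseChange ℚ).conductorNorm ℤ : ℕ) : ℝ) ^ κ ≤ ((max |W₀.Δ| (|W₀.c₄| ^ 3) : ℤ) : ℝ) ∧ ((max |W₀.Δ| (|W₀.c₄| ^ 3)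 : ℤ) : ℝ) ≤ (((W₀.baseChange ℚ).conductorNorm ℤ : ℕ) : ℝ) ^ σ} : ℝ) ≤ C * X ^ δ) → ∀ σ' : ℝ, σ < σ' → ∃ N₀ : ℝ, ∀ W₀ : WeierstrassCurve ℤ, (W₀.baseChange ℚ).IsElliptic → (∀ v : IsDedekindDomain.HeightOneSpectrum ℤ, (W₀.baseChange ℚ).IsMinimalAt v) → W₀.c₄ ≠ 0 → W₀.c₆ ≠ 0 → N₀ ≤ (((W₀.baseChange ℚ).conductorNorm ℤ : ℕ) : ℝ) → ((max |W₀.Δ| (|W₀.c₄| ^ 3) : ℤ) : ℝ) ≤ (((W₀.baseChange ℚ).conductorNorm ℤ : ℕ) : ℝ) ^ σ'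

/-- item stmt-ABC-2778 · support · rank 9 · closed · proved by Summit.ABC.ABC.Theorems.FreyAmplification_proof (prover) · by planner
[support] FREY–TWIST AMPLIFICATION, ARITHMETIC FORM (provable now; glue giving the route a second,
Tate-free arrow to the summit). Data t = (a,b,c,d): an abc triple and d = 1 or a prime with d ∤ abc
(d is automatically odd since 2 ∣ abc); these are the PRIME quadratic twists E_{a,b}^{(d)} of the
Frey curve, for which N ≍ rad(abc)·d² (up to 2^8) and M⁺ = max(|Δ_min|,|c₄|³) ≍ (cd)⁶ (c₄ =
16(a²+ab+b²) ∈ [12c²,16c²], (abc)² ≤ c⁶). The 'window at conductor scale X' is rad(abc)d² ≤ X and κ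
≤ 6·log(cd)/log(rad(abc)d²) ≤ σ, written with Real.log; the count is phrased as 'every finite set S
of window data has card ≤ C·X^{1−κ/6+ε}' (no ncard/finiteness side issue; the window is finite
anyway: cd ≤ X^{σ/6}). STATEMENT: if for some 3 < κ < 6 < σ this sharp window bound holds for every
ε > 0, then ABC (the summit, strict C-form). PROOF (elementary + PNT, ≈ Theorem A of the card
without any elliptic curve): fix ε₀ > 0 and suppose infinitely many triples have c ≥ rad^{1+ε₀}; for
such a triple put m = rad(abc) ≥ 2, c = m^q (q ≥ 1+ε₀), η = (6q−κ)/(2κ−6), D = m^η, X = m·D² =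
m^{1+2η}. For a prime d ∈ (D/2, D] with d ∤ abc the ratio 6(q+θ)/(1+2θ), θ = log d/log m, is
decreasing in θ, ≥ κ at θ = η and -/
@[route_item "route-ABC-TwistAmplification"]
def FreyAmplification : Prop :=
  (∃ κ σ : ℝ, 3 < κ ∧ κ < 6 ∧ 6 < σ ∧ ∀ ε : ℝ, 0 < ε → ∃ C : ℝ, ∀ X : ℝ, 1 ≤ X → ∀ S : Finset (ℕ × ℕ × ℕ × ℕ), (∀ t ∈ S, Literature.NumberTheory.DiophantineGeometry.IsABCTriple t.1 t.2.1 t.2.2.1 ∧ (t.2.2.2 = 1 ∨ Nat.Prime t.2.2.2) ∧ Nat.Coprime t.2.2.2 (t.1 * t.2.1 * t.2.2.1) ∧ ((Literature.NumberTheory.DiophantineGeometry.rad t.1 t.2.1 t.2.2.1 : ℕ) : ℝ) * (t.2.2.2 : ℝ) ^ 2 ≤ X ∧ κ * Real.log (((Literature.NumberTheory.DiophantineGeometry.rad t.1 t.2.1 t.2.2.1 : ℕ) : ℝ) * (t.2.2.2 : ℝ) ^ 2) ≤ 6 * Real.log ((t.2.2.1 : ℝ) * (t.2.2.2 : ℝ))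 ∧ 6 * Real.log ((t.2.2.1 : ℝ) * (t.2.2.2 : ℝ)) ≤ σ * Real.log (((Literature.NumberTheory.DiophantineGeometry.rad t.1 t.2.1 t.2.2.1 : ℕ) : ℝ) * (t.2.2.2 : ℝ) ^ 2)) → (S.card : ℝ) ≤ C * X ^ (1 - κ / 6 + ε)) → _root_.ABC

/-- item stmt-ABC-2793 · support · rank 9 · closed · proved by Summit.ABC.ABC.Theorems.SharpCountSandwich_proof (prover) · by planner
[support] THE SANDWICH (honesty clause of the triage, made exact and certifiable; calibration,
provable now): ABC → MazurKaneLaw → for EVERY 3 < κ < 6 < σ and ε > 0 the Frey–twist window count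
(data (a,b,c,d), d = 1 or prime ∤ abc, rad(abc)d² ≤ X, κ ≤ 6log(cd)/log(rad d²) ≤ σ; same predicate
as FreyAmplification) is ≤ C·X^{1−κ/6+ε}. Together with FreyAmplification (count ⟹ ABC) and the d =
1 specialisation (count at (κ,σ) ⟹ Mazur–Kane at s = 6/κ) this pins down what the route's counting
hypothesis contains: ABC ∧ MazurKane(1,6/κ] ⟹ SharpFreyCount(κ,σ) ⟹ ABC ∧ MazurKane{6/κ} — the
pointwise content is exactly abc, the statistical content is exactly Mazur's law below 2. PROOF
SKETCH: (1) twisting only lowers the ratio, so every window datum has quality q = log c/log rad ≥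
κ/6 > 1/2 and d ≤ min(rad^{η(q)}, (X/rad)^{1/2}), η(q) = (6q−κ)/(2κ−6). (2) Levels q ≥ 1+τ: by ABC
(finite-exceptions form, via abcQualityForm_iff_forall_exists_const in the tree) finitely many
triples, each with a bounded d-range (ratio must stay ≥ κ) — O_τ(1) data for all X. (3) Levels q ∈
[κ/6, 1): triples with rad ∈ [M,2M], quality ∈ [q, q+dq] are ≤ #{c ≤ (2M)^{q+dq}, rad(abc) ≤
c^{1/q}} ≪ M^{1−q+O(ε+dq)} by Maz -/
@[route_item "route-ABC-TwistAmplification"]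
def SharpCountSandwich : Prop :=
  _root_.ABC → MazurKaneLaw → ∀ κ σ : ℝ, 3 < κ → κ < 6 → 6 < σ → ∀ ε : ℝ, 0 < ε → ∃ C : ℝ, ∀ X : ℝ, 1 ≤ X → ∀ S : Finset (ℕ × ℕ × ℕ × ℕ), (∀ t ∈ S, Literature.NumberTheory.DiophantineGeometry.IsABCTriple t.1 t.2.1 t.2.2.1 ∧ (t.2.2.2 = 1 ∨ Nat.Prime t.2.2.2) ∧ Nat.Coprime t.2.2.2 (t.1 * t.2.1 * t.2.2.1) ∧ ((Literature.NumberTheory.DiophantineGeometry.rad t.1 t.2.1 t.2.2.1 : ℕ) : ℝ) * (t.2.2.2 : ℝ) ^ 2 ≤ X ∧ κ * Real.log (((Literature.NumberTheory.DiophantineGeometry.rad t.1 t.2.1 t.2.2.1 : ℕ) : ℝ) * (t.2.2.2 : ℝ) ^ 2) ≤ 6 * Real.log ((t.2.2.1 : ℝ) * (t.2.2.2 : ℝ)) ∧ 6 * Real.log ((t.2.2.1 : ℝ) * (t.2.2.2 : ℝ)) ≤ σ * Real.log (((Literature.NumberTheory.DiophantineGeometry.rad t.1 t.2.1 t.2.2.1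 : ℕ) : ℝ) * (t.2.2.2 : ℝ) ^ 2)) → (S.card : ℝ) ≤ C * X ^ (1 - κ / 6 + ε)

-- earlier Assembly (stmt-ABC-1974, replaced 2026-08-15T16:15:24Z -> stmt-ABC-10440): retired by None — QuadraticTwistInvariants → Literature.NumberTheory.DiophantineGeometry.finite_setOf_isABCTriple_primeFactors_subset → ModerateWindowCount → _root_.ABC
/-- item stmt-ABC-10440 · assembly · rank 1 · closed · proved by Summit.ABC.ABC.Theorems.twistAmplification_assembly_proof (prover) · by planner
sources: BombieriGubler2006, Mahler1933
[assembly] TwistAmplificationLemma → QuadraticTwistInvariants → ModerateWindowCount → ABC (repair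
2026-08-15: the PROVED Literature fact abc.S25 `finite_setOf_isABCTriple_primeFactors_subset` is no
longer a hypothesis — its proof `finite_setOf_isABCTriple_primeFactors_subset_holds`
(AbcWave0SUnitProofs, Mahler 1933 / S-unit equation) is USED inside the proof;
TwistAmplificationLemma (support 1978) is now an explicit hypothesis, so this item is pure Frey
bookkeeping, provable now, size M). Plan: given ε > 0 put σ := 6+3ε, take (κ, δ, C) from
ModerateWindowCount σ, feed the count into TwistAmplificationLemma with σ' := 6+6ε: an N₀ with
max(|Δ|,|c₄|³) ≤ N^{6+6ε} for every minimal integral model with c₄ ≠ 0, c₆ ≠ 0 and conductor N ≥ N₀.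
For an abc triple (a,b,c) use the in-tree minimal Frey models of SzpiroFreyProofs (freyIntModel
⟨0,B−A,0,−AB,0⟩ if 16 ∤ abc, freyIntModel₂ after exists_arrangement if 16 ∣ abc;
exists_minimal_frey_model gives IsElliptic, minimal at all v, N ∣ 2^10·rad(abc), c² ≤ 2|c₄|); add c₆
= −32(B−A)(2A+B)(A+2B) (resp. /2⁶), which vanishes only for the triple (1,1,2). Upper bound: c⁶ ≤
8|c₄|³ ≤ 8·N^{6+6ε} ≤ 8·(2^10 rad)^{6+6ε}, sixth root ⇒ c ≤ C′·rad^{1+ε}. Lower b -/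
@[route_item "route-ABC-TwistAmplification"]
def Assembly : Prop :=
  TwistAmplificationLemma → QuadraticTwistInvariants → ModerateWindowCount → _root_.ABC

end Summit.ABC.ABC.Theses.TwistAmplification
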